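import Summits.PneNP.PneNP.Theorems.ConvexRankGatesLinAlgGateBlindDefs

/-!
# Route ConvexRankGates, crux `LinAlgGateBlind` (stmt-PneNP-10681): the joint-closure criterion for PERM term gates

Support lemmas for the research stub `stub_sgPerm` (lines `dnf-invariant-wide-gates-see-small-cliques`,
`konig-atoms-cancellation-split`), vocabulary of `Theorems/ConvexRankGatesLinAlgGateBlindDefs.lean`. This is the
GROUP-theoretic (nonabelian PERM) counterpart of the span-program files
`Theorems/ConvexRankGatesLinAlgGateBlind{RigidSpanProgram,VisibleRigidity}.lean`.

A PERM term gate in unpacked form (the shape of `IsTermGate m (IsPermGate s) l O`): inputs `a : A`, each carrying a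
generator `σ a` of a group `Γ` (for PERM: `Γ = Equiv.Perm (Fin d)`) and a clique atom `atom a ∈ 𝒱(l)` (several inputs
may share an atom), a target `τ`, and `O(x) = [τ ∈ ⟨σ a : ⌈atom a⌉(x)⟩]`.

* `sg_of_avoiding_subgroup` (MAIN LEMMA): if ONE subgroup `H ∌ τ` contains `σ a` for every input `a` whose atom is
  present in some rejected `P`-graph, then `𝒜 := {atom a : σ a ∉ H}` loses no accepted bare clique and is silent on
  rejected `P`-graphs: `lostPos m k O 𝒜 = ∅ ∧ gainedNeg m q O 𝒜 ≤ Pr_{G(m,q)}[¬P]`.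
* `sg_of_not_mem_jointClosure` (EXACT CRITERION): the smallest such `H` is the JOINT CLOSURE
  `J_P := ⟨σ a : ⌈atom a⌉(G) for some rejected P-graph G⟩`; so `τ ∉ J_P` already gives SG with zero lost
  positives. Contrapositive, the one-line status of a PERM violator of `stub_sgPerm`: for every high-probability
  graph property `P`, the target must be generated by generators EACH of which is present in SOME typical rejected
  graph — rejection on typical graphs is not closed under pooling their present generators.
* `sg_of_productRigidPerm` (RIGIDITY CRITERION, group form of `sg_of_rigidSpanProgram`): if for any two
  `P`-graphs every generator factors as `σ a = b · τ^j` with `b` generated by the inputs present in BOTH, and `τ`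
  is recovered from each of its non-trivial powers (e.g. `τ` of prime order, `mem_zpowers_zpow_of_prime_orderOf`),
  then SG holds with zero lost positives: all rejected `P`-graphs generate inside `H = ⟨present in G₁⟩` for one
  rejected `P`-graph `G₁` (`σ a = b τ^j ∈ ⟨present in G⟩ ∌ τ` forces `τ^j = 1`). Commutativity is what the
  span-program files use at this step; for groups the product-set hypothesis `σ a ∈ B·⟨τ⟩` replaces it (a conjugate
  `τ b τ⁻¹` is NOT controlled — the honest nonabelian gap).

No new definitions. [folklore]
-/

-- `Summit.PneNP.PneNP.…` duplicates `PneNP` BY DESIGN (single-problem summit).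
set_option linter.dupNamespace false

namespace Summit.PneNP.PneNP.Theorems

open Finset Literature.Computability.Complexity Razborov
open Summit.PneNP.PneNP.Cruxes.LinAlgGateBlind.DnfInvariantWideGatesSeeSmallCliques

/-- **Main lemma (one `τ`-avoiding subgroup explains SG) for PERM-type term gates.** [folklore] -/
theorem sg_of_avoiding_subgroup {m l k : ℕ} {q : ℝ} (hq0 : 0 ≤ q) (hq1 : q ≤ 1) {Γ A : Type} [Group Γ]
    [Fintype A] (σ : A → Γ) (atom : A → Finset (Fin m)) (hatom : ∀ a, atom a ∈ smallSets (Fin m) l) (τ : Γ)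
    (O : (KEdge m → Bool) → Bool)
    (hO : ∀ x, O x = true ↔ τ ∈ Subgroup.closure (σ '' {a | CliquePresent (atom a) x}))
    (P : (KEdge m → Bool) → Prop) (H : Subgroup Γ) (hτH : τ ∉ H)
    (hH : ∀ G, P G → O G = false → ∀ a, CliquePresent (atom a) G → σ a ∈ H) :
    ∃ 𝒜 ⊆ smallSets (Fin m) l, lostPos m k O 𝒜 = ∅ ∧ gainedNeg m q O 𝒜 ≤ prob q (fun G => ¬ P G) := by
  classical
  refine ⟨(univ.filter fun a => σ a ∉ H).image atom, ?_, ?_, ?_⟩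
  · intro Y hY
    obtain ⟨a, -, rfl⟩ := mem_image.1 hY
    exact hatom a
  · refine filter_eq_empty_iff.2 fun S _ h => ?_
    obtain ⟨hS, hacc⟩ := h
    have hτS := (hO _).1 hS
    have hle : Subgroup.closure (σ '' {a | CliquePresent (atom a) (cliqueVec S)}) ≤ H := by
      refine (Subgroup.closure_le _).2 ?_
      rintro _ ⟨a, ha, rfl⟩
      by_contra haH
      exact hacc ⟨atom a, mem_image.2 ⟨a, mem_filter.2 ⟨mem_univ _, haH⟩, rfl⟩, ha⟩
    exact hτH (hle hτS)
  · refine prob_mono hq0 hq1 fun G hG hPG => ?_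
    obtain ⟨hOG, Y, hY, hYG⟩ := hG
    obtain ⟨a, ha, rfl⟩ := mem_image.1 hY
    exact (mem_filter.1 ha).2 (hH G hPG hOG a hYG)

/-- **The joint-closure criterion (exact form of the main lemma).** If the target is not generated by the pooled
generators of all rejected `P`-graphs, SG holds with zero lost positives and `gainedNeg ≤ Pr[¬P]`. [folklore] -/
theorem sg_of_not_mem_jointClosure :
    ∀ (m l k : ℕ) (q : ℝ), 0 ≤ q → q ≤ 1 →
    ∀ {Γ A : Type} [Group Γ] [Fintype A] (σ : A → Γ) (atom : A → Finset (Fin m)),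
      (∀ a, atom a ∈ smallSets (Fin m) l) →
    ∀ (τ : Γ) (O : (KEdge m → Bool) → Bool),
      (∀ x, O x = true ↔ τ ∈ Subgroup.closure (σ '' {a | CliquePresent (atom a) x})) →
    ∀ (P : (KEdge m → Bool) → Prop),
      τ ∉ Subgroup.closure (σ '' {a | ∃ G, P G ∧ O G = false ∧ CliquePresent (atom a) G}) →
      ∃ 𝒜 ⊆ smallSets (Fin m) l,
        lostPos m k O 𝒜 = ∅ ∧ gainedNeg m q O 𝒜 ≤ prob q (fun G => ¬ P G) := by
  intro m l k q hq0 hq1 Γ A _ _ σ atom hatom τ O hO P hτ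
  exact sg_of_avoiding_subgroup hq0 hq1 σ atom hatom τ O hO P _ hτ fun G hPG hOG a ha =>
    Subgroup.subset_closure ⟨a, ⟨G, hPG, hOG, ha⟩, rfl⟩

/-- **Product rigidity for PERM-type term gates (group form of `sg_of_rigidSpanProgram`).** If every generator
factors as `σ a = b * τ ^ j` with `b` generated by the inputs present in both of any two `P`-graphs, and `τ` lies in
the cyclic group of each of its non-trivial powers, then SG holds with zero lost positives and
`gainedNeg ≤ Pr[¬P]`. [folklore] -/
theorem sg_of_productRigidPerm :
    ∀ (m l k : ℕ) (q : ℝ), 0 ≤ q → q ≤ 1 →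
    ∀ {Γ A : Type} [Group Γ] [Fintype A] (σ : A → Γ) (atom : A → Finset (Fin m)),
      (∀ a, atom a ∈ smallSets (Fin m) l) →
    ∀ (τ : Γ) (O : (KEdge m → Bool) → Bool),
      (∀ x, O x = true ↔ τ ∈ Subgroup.closure (σ '' {a | CliquePresent (atom a) x})) →
      (∀ j : ℤ, τ ^ j ≠ 1 → τ ∈ Subgroup.zpowers (τ ^ j)) →
    ∀ (P : (KEdge m → Bool) → Prop),
      (∀ G G', P G → P G' → ∀ a, ∃ b ∈ Subgroup.closure
          (σ '' {a' | CliquePresent (atom a') G ∧ CliquePresent (atom a') G'}), ∃ j : ℤ, σ a = b * τ ^ j) →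
      ∃ 𝒜 ⊆ smallSets (Fin m) l,
        lostPos m k O 𝒜 = ∅ ∧ gainedNeg m q O 𝒜 ≤ prob q (fun G => ¬ P G) := by
  intro m l k q hq0 hq1 Γ A _ _ σ atom hatom τ O hO hτ P hrigid
  classical
  set W : (KEdge m → Bool) → Subgroup Γ := fun x =>
    Subgroup.closure (σ '' {a | CliquePresent (atom a) x}) with hW
  have hOW : ∀ x, O x = false → τ ∉ W x := fun x hx hτx => by
    have := (hO x).2 hτx
    rw [hx] at this
    exact Bool.false_ne_true this
  by_cases hwit : ∃ G₁, P G₁ ∧ O G₁ = false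
  · obtain ⟨G₁, hP₁, hO₁⟩ := hwit
    refine sg_of_avoiding_subgroup hq0 hq1 σ atom hatom τ O hO P (W G₁) (hOW G₁ hO₁) ?_
    intro G hPG hOG a haG
    obtain ⟨b, hb, j, hj⟩ := hrigid G₁ G hP₁ hPG a
    have hboth : Subgroup.closure (σ '' {a' | CliquePresent (atom a') G₁ ∧ CliquePresent (atom a') G}) ≤
        W G₁ ⊓ W G := by
      refine (Subgroup.closure_le _).2 ?_
      rintro _ ⟨a', ⟨h1, h2⟩, rfl⟩
      exact ⟨Subgroup.subset_closure ⟨a', h1, rfl⟩, Subgroup.subset_closure ⟨a', h2, rfl⟩⟩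
    have hb₁ : b ∈ W G₁ := (hboth hb).1
    have hbG : b ∈ W G := (hboth hb).2
    have haW : σ a ∈ W G := Subgroup.subset_closure ⟨a, haG, rfl⟩
    -- `τ ^ j = b⁻¹ * σ a ∈ W G`, so `τ ^ j = 1`
    have hpow : τ ^ j ∈ W G := by
      have : τ ^ j = b⁻¹ * σ a := by rw [hj, inv_mul_cancel_left]
      rw [this]
      exact (W G).mul_mem ((W G).inv_mem hbG) haW
    have hj1 : τ ^ j = 1 := by
      by_contra hne
      exact hOW G hOG ((Subgroup.zpowers_le.2 hpow) (hτ j hne))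
    rw [hj, hj1, mul_one]
    exact hb₁
  · -- no rejected `P`-graph: the constant-true DNF works
    push Not at hwit
    refine ⟨{∅}, by simp, ?_, ?_⟩
    · exact filter_eq_empty_iff.2 fun S _ h => h.2 (accepts_of_empty_mem (mem_singleton_self _) _)
    · exact prob_mono hq0 hq1 fun G hG hPG => absurd hG.1 (hwit G hPG)

/-- Elements of prime order are recovered from each of their non-trivial powers (the hypothesis on `τ` in
`sg_of_productRigidPerm`). [folklore] -/
theorem mem_zpowers_zpow_of_prime_orderOf {Γ : Type} [Group Γ] {τ : Γ} (hp : (orderOf τ).Prime) :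
    ∀ j : ℤ, τ ^ j ≠ 1 → τ ∈ Subgroup.zpowers (τ ^ j) := by
  intro j hj
  -- `orderOf τ ∤ j`, hence `gcd (j, orderOf τ) = 1`
  have hndvd : ¬ ((orderOf τ : ℤ) ∣ j) := fun h => hj (orderOf_dvd_iff_zpow_eq_one.1 h)
  have hcop : Int.gcd j (orderOf τ) = 1 := by
    have hg : (Int.gcd j (orderOf τ) : ℤ) ∣ (orderOf τ : ℤ) := Int.gcd_dvd_right _ _
    have hg' : Int.gcd j (orderOf τ) ∣ orderOf τ := by exact_mod_cast hg
    rcases (Nat.dvd_prime hp).1 hg' with h | h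
    · exact h
    · exfalso
      apply hndvd
      have := Int.gcd_dvd_left j (orderOf τ)
      rwa [h] at this
  have hbez := Int.gcd_eq_gcd_ab j (orderOf τ)
  rw [hcop, Nat.cast_one] at hbez
  refine Subgroup.mem_zpowers_iff.2 ⟨Int.gcdA j (orderOf τ), ?_⟩
  calc (τ ^ j) ^ Int.gcdA j (orderOf τ)
      = τ ^ (j * Int.gcdA j (orderOf τ)) * τ ^ ((orderOf τ : ℤ) * Int.gcdB j (orderOf τ)) := by
        rw [← zpow_mul, zpow_mul τ (orderOf τ : ℤ), zpow_natCast, pow_orderOf_eq_one, one_zpow, mul_one]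
    _ = τ ^ (1 : ℤ) := by rw [← zpow_add, ← hbez]
    _ = τ := zpow_one τ

end Summit.PneNP.PneNP.Theorems
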